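import Summits.CriticalPhenomena.PercolationContinuityZ3.Theorems.PercLowPointHalfSpaceBoundaryTwoArmDecayStubForestDefs

/-!
# Stub `stub_forest` of crux `BoundaryTwoArmDecay` (stmt-CriticalPhenomena-0911), part 2: boundedness, measurability,
# the height forest

Helper file for the stub `stub_forest` (the merge-forest inequality, THE LEVER of line
`merge-forest-level-bridges`) of the crux skeleton `Cruxes/BoundaryTwoArmDecay/Lines/merge_forest_level_bridges.lean`
(crux `PercLowPointHalfSpace.BoundaryTwoArmDecay`, stmt-CriticalPhenomena-0911); lands with
`--supports stmt-CriticalPhenomena-0911` (registered def-free sub-goals `stub_forest_packing`, `stub_forest_measurable`).  Definitions in part 1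
(`…StubForestDefs`); part 3 is `…StubForestPieces`, the stub itself `…StubForest`.

* Boundedness of `Dset` / `Nset` (an admissible family injects into `B_{5r}` / `B_r`), so `Dpieces`, `Nchain` are
  attained maxima (`le_Dpieces_of_mem`, `le_Nchain_of_mem`, `lt_Nchain_iff`, `Dpieces_eq_iff`).
* Measurability of `LBflatAt` (sub-goal), of `Dpieces` (bounded, hence integrable) and of `{M < Nchain}`: countable
  combinations of the events `{x ↔ y in S}` (`measurableSet_openConnIn_of_countable`) and of their preimages under the
  measurable map `ω ↦ ω ∖ {f}`.
* The laminar HEIGHT FOREST of `h`-big level clusters of one configuration: nodes are laminar (`node_laminar`),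
  same-level nodes sharing a vertex coincide; every node has a minimal node below it (`Mset_nonempty`, descending
  induction on the level); a minimal node strictly below a node lies below a unique CHILD (`child_of_mem_Mset`,
  `child_unique`); minimal nodes are pairwise vertex-disjoint (`minimals_disjoint`).
* The DESIGNATED-CHILD INJECTION (`eq_of_minM_eq`): over pairs `(n, c)`, `c` a child of `n` other than the designated
  child `dch n`, the least-ranked minimal node `minM c` below `c` determines the pair — the forest inequality
  `Σ_nodes (#children - 1)⁺ ≤ #leaves` in injective form.
-/

noncomputable section

namespace Summit.CriticalPhenomena.PercolationContinuityZ3.Theorems.BoundaryTwoArmDecay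

open MeasureTheory
open Literature.Probability.Percolation Literature.Probability.LatticeModels
open Summit.CriticalPhenomena.PercolationContinuityZ3.Theorems.BoundaryTwoArmDecay.Negative (H e μ)

namespace StubForest

variable {ω : BondConfig (Site 3)} {r h : ℕ}

/-! ### Boundedness of `Dset` and `Nset` -/

/-- An admissible family of pieces has at most `|B_{5r}|` members. -/
theorem le_card_of_mem_Dset {r h : ℕ} {ω : BondConfig (Site 3)} {k : ℕ} (hk : k ∈ Dset r h ω) :
    k ≤ (box 3 (5 * r)).card := by
  classical
  obtain ⟨S, hS1, -, hS3, hS4⟩ := hk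
  choose f hf using fun a => hS3 a
  have hinj : Function.Injective f := by
    intro a b hab
    by_contra hne
    have hdis := hS4 a b hne
    exact Finset.disjoint_left.1 hdis (hf a).1 (hab ▸ (hf b).1)
  calc k = (Finset.univ : Finset (Fin k)).card := by simp
    _ ≤ (box 3 (5 * r)).card := by
        refine Finset.card_le_card_of_injOn f (fun a _ => ?_) (hinj.injOn)
        exact ((hS1 a) (hf a).1).2

/-- `Dset` is bounded above. -/
theorem bddAbove_Dset (r h : ℕ) (ω : BondConfig (Site 3)) : BddAbove (Dset r h ω) :=
  ⟨(box 3 (5 * r)).card, fun _ hk => le_card_of_mem_Dset hk⟩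

/-- `0 ∈ Dset` (the empty family). -/
theorem zero_mem_Dset (r h : ℕ) (ω : BondConfig (Site 3)) : 0 ∈ Dset r h ω :=
  ⟨fun a => a.elim0, fun a => a.elim0, fun a => a.elim0, fun a => a.elim0, fun a => a.elim0⟩

/-- Membership in `Dset` bounds `Dpieces` from below. -/
theorem le_Dpieces_of_mem {r h : ℕ} {ω : BondConfig (Site 3)} {k : ℕ} (hk : k ∈ Dset r h ω) :
    k ≤ Dpieces r h ω :=
  le_csSup (bddAbove_Dset r h ω) hk

/-- `Dpieces ≤ |B_{5r}|`. -/
theorem Dpieces_le_card (r h : ℕ) (ω : BondConfig (Site 3)) : Dpieces r h ω ≤ (box 3 (5 * r)).card :=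
  csSup_le ⟨0, zero_mem_Dset r h ω⟩ fun _ hk => le_card_of_mem_Dset hk

/-- An admissible chain has at most `|B_r|` members. -/
theorem le_card_of_mem_Nset {r h : ℕ} {ω : BondConfig (Site 3)} {m : ℕ} (hm : m ∈ Nset r h ω) :
    m ≤ (box 3 r).card := by
  classical
  obtain ⟨t, u, v, x, hinj, -, hx⟩ := hm
  calc m = (Finset.univ : Finset (Fin m)).card := by simp
    _ ≤ (box 3 r).card :=
        Finset.card_le_card_of_injOn x (fun a _ => (hx a).2.1) hinj.injOn

/-- `Nset` is bounded above. -/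
theorem bddAbove_Nset (r h : ℕ) (ω : BondConfig (Site 3)) : BddAbove (Nset r h ω) :=
  ⟨(box 3 r).card, fun _ hm => le_card_of_mem_Nset hm⟩

/-- `0 ∈ Nset` (the empty chain). -/
theorem zero_mem_Nset (r h : ℕ) (ω : BondConfig (Site 3)) : 0 ∈ Nset r h ω :=
  ⟨0, 0, 0, fun a => a.elim0, fun a => a.elim0, le_rfl, fun a => a.elim0⟩

/-- Membership in `Nset` bounds `Nchain` from below. -/
theorem le_Nchain_of_mem {r h : ℕ} {ω : BondConfig (Site 3)} {m : ℕ} (hm : m ∈ Nset r h ω) :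
    m ≤ Nchain r h ω :=
  le_csSup (bddAbove_Nset r h ω) hm

/-- `Nchain` is attained: `M < Nchain ↔ ∃ m ∈ Nset, M < m`. -/
theorem lt_Nchain_iff {r h : ℕ} {ω : BondConfig (Site 3)} {M : ℕ} :
    M < Nchain r h ω ↔ ∃ m ∈ Nset r h ω, M < m :=
  ⟨fun hM => ⟨_, Nat.sSup_mem ⟨0, zero_mem_Nset r h ω⟩ (bddAbove_Nset r h ω), hM⟩,
    fun ⟨_, hm, hMm⟩ => lt_of_lt_of_le hMm (le_Nchain_of_mem hm)⟩

/-- `Dpieces` is the greatest element of `Dset`. -/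
theorem Dpieces_eq_iff {r h : ℕ} {ω : BondConfig (Site 3)} {k : ℕ} :
    Dpieces r h ω = k ↔ k ∈ Dset r h ω ∧ ∀ k' ∈ Dset r h ω, k' ≤ k := by
  have hmem : Dpieces r h ω ∈ Dset r h ω :=
    Nat.sSup_mem ⟨0, zero_mem_Dset r h ω⟩ (bddAbove_Dset r h ω)
  constructor
  · rintro rfl
    exact ⟨hmem, fun k' hk' => le_Dpieces_of_mem hk'⟩
  · rintro ⟨hk, hmax⟩
    exact le_antisymm (hmax _ hmem) (le_Dpieces_of_mem hk)

/-! ### Measurability -/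

/-- Closing one edge is a measurable map of configurations. -/
theorem measurable_diff_singleton (f : Sym2 (Site 3)) : Measurable fun ω : BondConfig (Site 3) => ω \ {f} :=
  measurable_set_iff.2 fun g => (measurable_set_mem g).and measurable_const

/-- `ω ↦ (ω ∈ {a ↔ b in S})` is measurable. -/
theorem measurable_mem_conn (S : Set (Site 3)) (a b : Site 3) :
    Measurable fun ω : BondConfig (Site 3) => ω ∈ openConnIn S a b :=
  (measurableSet_openConnIn_of_countable S a b).mem

/-- `ω ↦ (ω ∖ f ∈ {a ↔ b in S})` is measurable. -/
theorem measurable_diff_mem_conn (f : Sym2 (Site 3)) (S : Set (Site 3)) (a b : Site 3) :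
    Measurable fun ω : BondConfig (Site 3) => ω \ {f} ∈ openConnIn S a b :=
  (measurable_mem_conn S a b).comp (measurable_diff_singleton f)

/-- `BigAbove h t u` is measurable. -/
theorem measurable_mem_bigAbove (h : ℕ) (t : ℤ) (u : Site 3) :
    Measurable fun ω : BondConfig (Site 3) => ω ∈ BigAbove h t u :=
  Measurable.exists fun v => Measurable.exists fun w =>
    (measurable_mem_conn _ u v).and ((measurable_mem_conn _ u w).and measurable_const)

/-- One ♭-witness clause is measurable. -/
theorem measurable_witness (r h : ℕ) (x y : Site 3) :
    Measurable fun ω : BondConfig (Site 3) => ∃ u : Site 3, u - y ∈ box 3 r ∧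
      ω \ {fl x} ∈ openConnIn (Hge (x 0)) y u ∧ ω ∈ BigAbove h (x 0) u :=
  Measurable.exists fun u => measurable_const.and ((measurable_diff_mem_conn _ _ _ u).and
    (measurable_mem_bigAbove h (x 0) u))

/-- **The ♭-event is measurable.** -/
theorem measurableSet_LBflatAt (r h : ℕ) (x : Site 3) : MeasurableSet (LBflatAt r h x) :=
  measurableSet_setOf.2 <| (measurable_set_mem (fl x)).and <| (measurable_diff_mem_conn _ _ _ _).not.and <|
    (measurable_witness r h x x).and (measurable_witness r h x (x + e))

/-- `ω ↦ (k ∈ Dset r h ω)` is measurable. -/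
theorem measurable_mem_Dset (r h k : ℕ) : Measurable fun ω : BondConfig (Site 3) => k ∈ Dset r h ω :=
  Measurable.exists fun S => measurable_const.and <| Measurable.and
    (Measurable.forall fun a => Measurable.forall fun u => measurable_const.imp <|
      Measurable.forall fun v => measurable_const.imp (measurable_mem_conn (↑(S a)) u v))
    measurable_const

/-- **`D(r,h)` is measurable.** -/
theorem measurable_Dpieces (r h : ℕ) : Measurable (Dpieces r h) := by
  refine measurable_to_countable' fun k => ?_
  have hset : Dpieces r h ⁻¹' {k} = {ω | k ∈ Dset r h ω ∧ ∀ k', k' ∈ Dset r h ω → k' ≤ k} := by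
    ext ω
    simp only [Set.mem_preimage, Set.mem_singleton_iff, Set.mem_setOf_eq]
    exact Dpieces_eq_iff
  rw [hset]
  exact measurableSet_setOf.2 ((measurable_mem_Dset r h k).and
    (Measurable.forall fun k' => (measurable_mem_Dset r h k').imp measurable_const))

/-- `ω ↦ D(r,h)(ω)` as a real random variable is measurable. -/
theorem measurable_Dpieces_real (r h : ℕ) : Measurable fun ω => (Dpieces r h ω : ℝ) :=
  (Measurable.of_discrete (f := fun k : ℕ => (k : ℝ))).comp (measurable_Dpieces r h)

/-- `ω ↦ D(r,h)(ω)` is integrable (bounded by `|B_{5r}|`). -/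
theorem integrable_Dpieces (r h : ℕ) : Integrable (fun ω => (Dpieces r h ω : ℝ)) μ := by
  refine Integrable.of_bound (measurable_Dpieces_real r h).aestronglyMeasurable ((box 3 (5 * r)).card : ℝ)
    (ae_of_all _ fun ω => ?_)
  rw [Real.norm_eq_abs, abs_of_nonneg (Nat.cast_nonneg _)]
  exact_mod_cast Dpieces_le_card r h ω

/-- `ω ↦ (m ∈ Nset r h ω)` is measurable. -/
theorem measurable_mem_Nset (r h m : ℕ) : Measurable fun ω : BondConfig (Site 3) => m ∈ Nset r h ω :=
  Measurable.exists fun t => Measurable.exists fun u => Measurable.exists fun v => Measurable.exists fun x =>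
    measurable_const.and <| measurable_const.and <| Measurable.forall fun a => measurable_const.and <|
      measurable_const.and <| (measurableSet_LBflatAt r h (x a)).mem.and <|
        (measurable_mem_conn (Hge t) u v).and (measurable_diff_mem_conn _ _ u v).not

/-- **`{M < N(r,h)}` is measurable.** -/
theorem measurableSet_lt_Nchain (r h M : ℕ) : MeasurableSet {ω | M < Nchain r h ω} := by
  have hset : {ω | M < Nchain r h ω} = {ω | ∃ m, m ∈ Nset r h ω ∧ M < m} := by
    ext ω
    simp only [Set.mem_setOf_eq, lt_Nchain_iff]
  rw [hset]
  exact measurableSet_setOf.2 (Measurable.exists fun m => (measurable_mem_Nset r h m).and measurable_const)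

/-! ### The height forest: laminarity, minimal nodes, the designated-child injection -/

/-- The generator of a node lies in the window and generates the node. -/
theorem gen_spec {n : ℤ × Set (Site 3)} (hn : n ∈ nodes ω r h) :
    gen ω r n ∈ Bw r ∧ n.2 = K ω n.1 (gen ω r n) := by
  have h' : ∃ z ∈ Bw r, n.2 = K ω n.1 z := (mem_nodes_iff.1 hn).2.2.2
  rw [gen, dif_pos h']
  exact h'.choose_spec

/-- The generator of a node is one of its vertices. -/
theorem gen_mem {n : ℤ × Set (Site 3)} (hn : n ∈ nodes ω r h) : gen ω r n ∈ n.2 := by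
  obtain ⟨w, hw⟩ := nonempty_of_big (mem_nodes_iff.1 hn).2.2.1
  rw [(gen_spec hn).2] at hw ⊢
  exact self_mem_K_of_mem hw

/-- Two nodes of the same level sharing a vertex are equal. -/
theorem node_eq_of_mem_of_mem {n n' : ℤ × Set (Site 3)} (hn : n ∈ nodes ω r h) (hn' : n' ∈ nodes ω r h)
    (hl : n.1 = n'.1) {w : Site 3} (hw : w ∈ n.2) (hw' : w ∈ n'.2) : n = n' := by
  obtain ⟨-, hz⟩ := gen_spec hn
  obtain ⟨-, hz'⟩ := gen_spec hn'
  refine Prod.ext hl ?_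
  rw [hz] at hw ⊢
  rw [hz'] at hw' ⊢
  rw [hl] at hw ⊢
  exact (K_eq_of_mem_of_mem hw' hw).symm

/-- **Laminarity of nodes**: a node of a higher level sharing a vertex with a node lies inside it. -/
theorem node_laminar {n n' : ℤ × Set (Site 3)} (hn : n ∈ nodes ω r h) (hn' : n' ∈ nodes ω r h)
    (hl : n.1 ≤ n'.1) {w : Site 3} (hw' : w ∈ n'.2) (hw : w ∈ n.2) : n'.2 ⊆ n.2 := by
  obtain ⟨-, hz⟩ := gen_spec hn
  obtain ⟨-, hz'⟩ := gen_spec hn'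
  rw [hz] at hw ⊢
  rw [hz'] at hw' ⊢
  exact K_laminar hl hw' hw

/-- `Mset` is monotone along the forest order. -/
theorem Mset_mono {n n' : ℤ × Set (Site 3)} (hl : n.1 ≤ n'.1) (hs : n'.2 ⊆ n.2) :
    Mset ω r h n' ⊆ Mset ω r h n := by
  intro m hm
  rw [mem_Mset_iff] at hm ⊢
  exact ⟨hm.1, hl.trans hm.2.1, hm.2.2.trans hs⟩

/-- `rank` is injective on the minimal nodes. -/
theorem rank_injOn {m m' : ℤ × Set (Site 3)} (hm : m ∈ minimals ω r h) (hm' : m' ∈ minimals ω r h)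
    (hr : rank ω r h m = rank ω r h m') : m = m' := by
  rw [rank, dif_pos hm, rank, dif_pos hm'] at hr
  have := (minimals ω r h).equivFin.injective (Fin.ext hr)
  exact congrArg Subtype.val this

/-- The designated minimal node lies below `n` and has least rank there. -/
theorem minM_spec {n : ℤ × Set (Site 3)} (hn : (Mset ω r h n).Nonempty) :
    minM ω r h n ∈ Mset ω r h n ∧ ∀ m ∈ Mset ω r h n, rank ω r h (minM ω r h n) ≤ rank ω r h m := by
  rw [minM, dif_pos hn]
  exact (Finset.exists_min_image (Mset ω r h n) (rank ω r h) hn).choose_spec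

/-- **Heredity of the designated minimal node**: if `Mset n' ⊆ Mset n` contains `minM n`, then
`minM n' = minM n`. -/
theorem minM_eq_of_subset {n n' : ℤ × Set (Site 3)} (hsub : Mset ω r h n' ⊆ Mset ω r h n)
    (hmem : minM ω r h n ∈ Mset ω r h n') : minM ω r h n' = minM ω r h n := by
  have h' := minM_spec ⟨_, hmem⟩
  have h := minM_spec ⟨_, hsub hmem⟩
  refine rank_injOn (mem_Mset_iff.1 h'.1).1 (mem_Mset_iff.1 h.1).1 (le_antisymm (h'.2 _ hmem) ?_)
  exact h.2 _ (hsub h'.1)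

/-- **Parent chain.** A minimal node `m` strictly below a node `n` lies below a CHILD of `n`, namely the
`H_{s+1}`-cluster of its generator (`s` the level of `n`), which is a node. -/
theorem child_of_mem_Mset {n m : ℤ × Set (Site 3)} (hn : n ∈ nodes ω r h) (hm : m ∈ Mset ω r h n)
    (hne : m ≠ n) :
    (n.1 + 1, K ω (n.1 + 1) (gen ω r m)) ∈ nodes ω r h ∧ K ω (n.1 + 1) (gen ω r m) ⊆ n.2 ∧
      m ∈ Mset ω r h (n.1 + 1, K ω (n.1 + 1) (gen ω r m)) := by
  obtain ⟨hmmin, hl, hsub⟩ := mem_Mset_iff.1 hm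
  have hmn : m ∈ nodes ω r h := (mem_minimals_iff.1 hmmin).1
  obtain ⟨hn0, -, -, z, -, hz⟩ := mem_nodes_iff.1 hn
  obtain ⟨-, hm1, hmbig, -⟩ := mem_nodes_iff.1 hmn
  obtain ⟨hgB, hgK⟩ := gen_spec hmn
  have hgm : gen ω r m ∈ m.2 := gen_mem hmn
  have hlt : n.1 + 1 ≤ m.1 := by
    rcases lt_or_eq_of_le hl with h1 | h1
    · omega
    · exact absurd (node_eq_of_mem_of_mem hmn hn h1.symm hgm (hsub hgm)) hne
  have hKm : m.2 ⊆ K ω (n.1 + 1) (gen ω r m) := by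
    rw [hgK]
    exact K_mono hlt _
  have hKn : K ω (n.1 + 1) (gen ω r m) ⊆ n.2 := by
    have hgn : gen ω r m ∈ K ω n.1 z := hz ▸ hsub hgm
    rw [hz, ← K_eq_of_mem hgn]
    exact K_mono (by omega) _
  exact ⟨mem_nodes_iff.2 ⟨by omega, by omega, big_mono hmbig hKm, gen ω r m, hgB, rfl⟩, hKn,
    mem_Mset_iff.2 ⟨hmmin, hlt, hKm⟩⟩

/-- Uniqueness of the child containing a given node. -/
theorem child_unique {n m c : ℤ × Set (Site 3)} (hm : m ∈ nodes ω r h) (hc : c ∈ nodes ω r h)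
    (hcl : c.1 = n.1 + 1) (hsub : m.2 ⊆ c.2) : c = (n.1 + 1, K ω (n.1 + 1) (gen ω r m)) := by
  obtain ⟨-, hz⟩ := gen_spec hc
  have hg : gen ω r m ∈ K ω c.1 (gen ω r c) := hz ▸ hsub (gen_mem hm)
  refine Prod.ext hcl ?_
  change c.2 = K ω (n.1 + 1) (gen ω r m)
  rw [hz, ← hcl, K_eq_of_mem hg]

/-- **Every node has a minimal node below it** (descending induction on the level). -/
theorem Mset_nonempty {n : ℤ × Set (Site 3)} (hn : n ∈ nodes ω r h) : (Mset ω r h n).Nonempty := by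
  obtain ⟨h0, h1, -, -⟩ := mem_nodes_iff.1 hn
  obtain ⟨k, hk⟩ : ∃ k : ℕ, n.1 + k = r + 1 := ⟨(r + 1 - n.1).toNat, by omega⟩
  induction k generalizing n with
  | zero =>
    refine ⟨n, mem_Mset_iff.2 ⟨mem_minimals_iff.2 ⟨hn, fun c hc hch => ?_⟩, le_rfl, subset_rfl⟩⟩
    have := (mem_nodes_iff.1 hc).2.1
    omega
  | succ k ih =>
    by_cases hmin : n ∈ minimals ω r h
    · exact ⟨n, mem_Mset_iff.2 ⟨hmin, le_rfl, subset_rfl⟩⟩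
    · rw [mem_minimals_iff] at hmin
      push Not at hmin
      obtain ⟨c, hc, hc1, hc2⟩ := hmin hn
      obtain ⟨m, hm⟩ := ih hc (mem_nodes_iff.1 hc).1 (mem_nodes_iff.1 hc).2.1 (by omega)
      exact ⟨m, Mset_mono (by omega) hc2 hm⟩

/-- The designated minimal node of a node is a minimal node below it. -/
theorem minM_mem {n : ℤ × Set (Site 3)} (hn : n ∈ nodes ω r h) : minM ω r h n ∈ Mset ω r h n :=
  (minM_spec (Mset_nonempty hn)).1

/-- **Minimal nodes are pairwise vertex-disjoint.** -/
theorem minimals_disjoint {m m' : ℤ × Set (Site 3)} (hm : m ∈ minimals ω r h) (hm' : m' ∈ minimals ω r h)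
    (hne : m ≠ m') : Disjoint m.2 m'.2 := by
  -- one direction of the level comparison suffices
  have key : ∀ {m m' : ℤ × Set (Site 3)}, m ∈ minimals ω r h → m' ∈ minimals ω r h → m.1 ≤ m'.1 →
      ∀ {w : Site 3}, w ∈ m.2 → w ∈ m'.2 → m = m' := by
    intro m m' hm hm' hl w hw hw'
    have hmn : m ∈ nodes ω r h := (mem_minimals_iff.1 hm).1
    have hmn' : m' ∈ nodes ω r h := (mem_minimals_iff.1 hm').1
    have hsub : m'.2 ⊆ m.2 := node_laminar hmn hmn' hl hw' hw
    by_contra hne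
    have hM : m' ∈ Mset ω r h m := mem_Mset_iff.2 ⟨hm', hl, hsub⟩
    obtain ⟨hc, hcs, -⟩ := child_of_mem_Mset hmn hM (Ne.symm hne)
    exact (mem_minimals_iff.1 hm).2 _ hc ⟨rfl, hcs⟩
  rw [Set.disjoint_left]
  intro w hw hw'
  rcases le_total m.1 m'.1 with hl | hl
  · exact hne (key hm hm' hl hw hw')
  · exact hne (key hm' hm hl hw' hw).symm

/-- The designated child of a non-minimal node is a child node containing the designated minimal node. -/
theorem dch_spec {n : ℤ × Set (Site 3)} (hn : n ∈ nodes ω r h) (hnm : n ∉ minimals ω r h) :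
    dch ω r h n ∈ nodes ω r h ∧ (dch ω r h n).2 ⊆ n.2 ∧ minM ω r h n ∈ Mset ω r h (dch ω r h n) := by
  have hμ := minM_mem hn
  have hne : minM ω r h n ≠ n := fun h' => hnm (h' ▸ (mem_Mset_iff.1 hμ).1)
  exact child_of_mem_Mset hn hμ hne

/-- A node with a child is not minimal. -/
theorem not_mem_minimals_of_child {n c : ℤ × Set (Site 3)} (hc : c ∈ nodes ω r h) (hcl : c.1 = n.1 + 1)
    (hcs : c.2 ⊆ n.2) : n ∉ minimals ω r h :=
  fun hn => (mem_minimals_iff.1 hn).2 c hc ⟨hcl, hcs⟩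

/-- **The designated-child injection.** Over pairs `(n, c)` — `c` a child of the node `n` other than its
designated child — the designated minimal node `minM c` determines the pair. -/
theorem eq_of_minM_eq {n c n' c' : ℤ × Set (Site 3)} (hn : n ∈ nodes ω r h) (hc : c ∈ nodes ω r h)
    (hcl : c.1 = n.1 + 1) (hcs : c.2 ⊆ n.2) (hn' : n' ∈ nodes ω r h)
    (hc' : c' ∈ nodes ω r h) (hcl' : c'.1 = n'.1 + 1) (hcs' : c'.2 ⊆ n'.2) (hcd' : c' ≠ dch ω r h n')
    (hcd : c ≠ dch ω r h n) (heq : minM ω r h c = minM ω r h c') : n = n' ∧ c = c' := by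
  -- one direction of the level comparison suffices
  have key : ∀ {n c n' c' : ℤ × Set (Site 3)}, n ∈ nodes ω r h → c ∈ nodes ω r h → c.1 = n.1 + 1 →
      c.2 ⊆ n.2 → n' ∈ nodes ω r h → c' ∈ nodes ω r h → c'.1 = n'.1 + 1 → c'.2 ⊆ n'.2 →
      c' ≠ dch ω r h n' → minM ω r h c = minM ω r h c' → c.1 ≤ c'.1 → n = n' ∧ c = c' := by
    intro n c n' c' hn hc hcl hcs hn' hc' hcl' hcs' hcd' heq hle
    have hμc : minM ω r h c ∈ Mset ω r h c := minM_mem hc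
    have hμc' : minM ω r h c ∈ Mset ω r h c' := heq ▸ minM_mem hc'
    obtain ⟨hμmin, -, hμs⟩ := mem_Mset_iff.1 hμc
    obtain ⟨-, hμl', hμs'⟩ := mem_Mset_iff.1 hμc'
    have hμn : minM ω r h c ∈ nodes ω r h := (mem_minimals_iff.1 hμmin).1
    obtain ⟨w, hw⟩ := nonempty_of_big (mem_nodes_iff.1 hμn).2.2.1
    rcases eq_or_lt_of_le hle with hl | hl
    · have hcc' : c = c' := node_eq_of_mem_of_mem hc hc' hl (hμs hw) (hμs' hw)
      subst hcc'
      exact ⟨node_eq_of_mem_of_mem hn hn' (by omega) (hcs (hμs hw)) (hcs' (hμs hw)), rfl⟩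
    · exfalso
      have hsub : n'.2 ⊆ c.2 := node_laminar hc hn' (by omega) (hcs' (hμs' hw)) (hμs hw)
      have hM : Mset ω r h n' ⊆ Mset ω r h c := Mset_mono (by omega) hsub
      have hmem : minM ω r h c ∈ Mset ω r h n' := mem_Mset_iff.2 ⟨hμmin, by omega, hμs'.trans hcs'⟩
      have hmin : minM ω r h n' = minM ω r h c := minM_eq_of_subset hM hmem
      apply hcd'
      rw [child_unique hμn hc' hcl' hμs', dch, hmin]
  rcases le_total c.1 c'.1 with hle | hle
  · exact key hn hc hcl hcs hn' hc' hcl' hcs' hcd' heq hle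
  · obtain ⟨h1, h2⟩ := key hn' hc' hcl' hcs' hn hc hcl hcs hcd heq.symm hle
    exact ⟨h1.symm, h2.symm⟩

/-! ### Registered sub-goals -/

/-- **Registered sub-goal `stub_forest_packing`** (def-free): an admissible family of pairwise disjoint pieces in
`ℍ ∩ B_{5r}` has at most `|B_{5r}|` members (so `Dpieces` is an attained maximum). -/
theorem stub_forest_packing : ∀ (r h : ℕ) (ω : BondConfig (Site 3)) (k : ℕ), (∃ S : Fin k → Finset (Site 3), (∀ a, (↑(S a) : Set (Site 3)) ⊆ {z : Site 3 | 0 ≤ z 0} ∩ ↑(box 3 (5 * r))) ∧ (∀ a, ∀ u ∈ S a, ∀ v ∈ S a, ω ∈ openConnIn (↑(S a) : Set (Site 3)) u v) ∧ (∀ a, ∃ u ∈ S a, ∃ v ∈ S a, ∃ i : Fin 3, (h : ℤ) ≤ 2 * |u i - v i|) ∧ (∀ a b, a ≠ b → Disjoint (S a) (S b))) → k ≤ (box 3 (5 * r)).card :=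
  fun _ _ _ _ hk => le_card_of_mem_Dset hk

/-- **Registered sub-goal `stub_forest_measurable`** (def-free): the ♭-event `LB♭(r,h)` at a root `x` is measurable
(verbatim the unfolding of `measurableSet_LBflatAt`). -/
theorem stub_forest_measurable : ∀ (r h : ℕ) (x : Site 3), MeasurableSet {ω : BondConfig (Site 3) | s(x, x + Pi.single 1 1) ∈ ω ∧ ω \ {s(x, x + Pi.single 1 1)} ∉ openConnIn {z : Site 3 | x 0 ≤ z 0} x (x + Pi.single 1 1) ∧ (∃ u : Site 3, u - x ∈ box 3 r ∧ ω \ {s(x, x + Pi.single 1 1)} ∈ openConnIn {z : Site 3 | x 0 ≤ z 0} x u ∧ ∃ v w : Site 3, ω ∈ openConnIn {z : Site 3 | x 0 + 1 ≤ z 0} u v ∧ ω ∈ openConnIn {z : Site 3 | x 0 + 1 ≤ z 0} u w ∧ ∃ i : Fin 3, (h : ℤ) ≤ |v i - w i|) ∧ (∃ u : Site 3, u - (x + Pi.single 1 1) ∈ box 3 r ∧ ω \ {s(x, x + Pi.single 1 1)} ∈ openConnIn {z : Site 3 | x 0 ≤ z 0} (x + Pi.single 1 1) u ∧ ∃ v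 w : Site 3, ω ∈ openConnIn {z : Site 3 | x 0 + 1 ≤ z 0} u v ∧ ω ∈ openConnIn {z : Site 3 | x 0 + 1 ≤ z 0} u w ∧ ∃ i : Fin 3, (h : ℤ) ≤ |v i - w i|)} :=
  fun r h x => measurableSet_LBflatAt r h x

end StubForest

end Summit.CriticalPhenomena.PercolationContinuityZ3.Theorems.BoundaryTwoArmDecay

end
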